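import Literature.AlgebraicGeometry.HodgeTheory.WeilClassesBlochSeed
import Literature.AlgebraicGeometry.HodgeTheory.BlochSemiregularHilbertPointSmooth
import Literature.AlgebraicGeometry.Motives.AbelianVarietyProjectiveChart
import HarnessLib

/-!
# A Bloch seed is a smooth point of the Hilbert scheme of its anchor (Bloch 1972, Thm. (7.3) at a (7.5)-seed)

Family `hodge`, layer `Literature/AlgebraicGeometry/HodgeTheory`. PROVED consumer composition, NO new fact (D-0026):
the seed predicate `HasBlochSeedAt n P h w` of the Weil ladder (`WeilClassesBlochSeed.lean`; [Bloch1972Semiregularity,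
Remark (7.5)]: a Bloch-semiregular local complete intersection `i : Z ↪ P` of codimension `n` whose class carries
`q·hⁿ + w`) COMPOSES with the typed fact `Bloch1972_hilbertScheme_smoothAt_semiregular` ([Bloch1972Semiregularity,
Thm. (7.3)]: «Let `X` be smooth and projective over `ℂ`. Let `Z ⊂ X` be a local complete intersection which is
semi-regular in `X`. Then the corresponding point `Z ∈ Hilb(X∕ℂ)` is smooth», infinitesimal-lifting form,
`BlochSemiregularHilbertPointSmooth.lean`) on an abelian `2n`-fold `P`: the binders `IsRegularImmersionOfCodim i n` and
`IsBlochSemiregular i (2n) n` of the seed ARE the hypotheses of (7.3), and `P` is smooth projective of dimension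
`2n = P.dim` by the tree's theorem `AbelianVariety.isSmoothProjective_holds` ([GortzWedhorn2023, Prop. 27.174]). Hence
every embedded deformation of the seed `Z` over a local Artinian `B` extends along every small surjection `A ↠ B`
— the seed is an unobstructed point of `Hilb(P)`. This is the composition signature asked for by the ladder director
for the №3 consumers (route `EightfoldBlochSeeds`, `BlochSeedDiscOne`: `HasHyperbolicBlochSeed 4 1` carries
`P.dim = 2 * 4` and `HasBlochSeedAt 4 P h_K w`; PAD-4 `stub_rung_pad4_seedAt … HasBlochSeedAt 4 …`), typed in the
literature-typing tranche LT-H1 «semiregularity consumers» (director-hodge g4∕g5, 2026-08-26). It is the FIXED-anchor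
statement; the SIDEWAYS statement the route's `closes` consumes is the class-level spread `BlochSemiregularSpread (2n) n`
([Bloch1972Semiregularity, Thm. (7.4)∕(7.5)]) through `weilAnchorLocalClause_of_blochSpread_of_blochSeedAt`, unchanged.
Nothing here asserts HC ∕ HC_AV ∕ any Weil-class statement, nor that any seed exists.

## References

* [Bloch1972Semiregularity] S. Bloch, Semi-regularity and de Rham cohomology, Invent. Math. 17 (1972) 51–66,
  Thm. (7.3), Thm. (7.4), Remark (7.5).
* [GortzWedhorn2023] U. Görtz, T. Wedhorn, Algebraic Geometry II, Prop. 27.174 (abelian varieties are smooth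
  projective).
* [BuchweitzFlenner2003] Compositio Math. 137 (2003), Cor. 7.10 with Rem. 7.11 (1) (the modern form of (7.3)).
-/

noncomputable section

open CategoryTheory CategoryTheory.Limits AlgebraicGeometry

namespace Literature.AlgebraicGeometry.HodgeTheory

open Literature.AlgebraicTopology.SingularHomology Literature.AlgebraicGeometry.Motives

/-- **A Bloch seed is an unobstructed point of the Hilbert scheme of its anchor** ([Bloch1972Semiregularity, Thm. (7.3)]
at the semiregular local complete intersection of [Bloch1972Semiregularity, Remark (7.5)]). Granting the fact
`Bloch1972_hilbertScheme_smoothAt_semiregular`, for an abelian variety `P` of dimension `2n` and a Bloch seed for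
`q·hⁿ + w` on `P` (`HasBlochSeedAt n P h w`), the seed's subscheme `i : Z ↪ P` — closed, a regular immersion of
codimension `n`, integral, of pure codimension `≥ n`, Bloch-semiregular, carrying `q·hⁿ + w` — has unobstructed
embedded deformations in `P`: every closed `Z_B ⊆ P × Spec B`, flat over the local Artinian `B` and restricting to `Z`,
extends along every small surjection `A ↠ B` to a closed `Z_A ⊆ P × Spec A` flat over `A` restricting to `Z_B` (the
telescope of `Bloch1972_hilbertScheme_smoothAt_semiregular` verbatim, with `X := P.X`, `ι₀ := i`; `P` is smooth
projective of dimension `P.dim = 2n` by `AbelianVariety.isSmoothProjective_holds`). PROVED composition; no new fact.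
[cite: Bloch1972Semiregularity, Thm. (7.3) and Remark (7.5)] [cite: GortzWedhorn2023, Prop. 27.174] -/
theorem HasBlochSeedAt.exists_seed_hilbertPointSmooth (hBl : Bloch1972_hilbertScheme_smoothAt_semiregular) {n : ℕ}
    {P : Motives.AbelianVariety ℂ} {h : complexBetti P.X 2} {w : complexBetti P.X (2 * n)} (hP : P.dim = 2 * n)
    (hS : HasBlochSeedAt n P h w) :
    ∃ (Z : Scheme.{0}) (i : Z ⟶ P.X.left) (q : ℚ),
      IsClosedImmersion i ∧ IsRegularImmersionOfCodim i n ∧ AlgebraicGeometry.IsIntegral Z ∧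
      (∀ z ∈ Set.range i.base, (n : ℕ∞) ≤ Order.coheight z) ∧
      IsBlochSemiregular i (2 * n) n ∧
      ((q : ℚ) : ℂ) • cupPowTwo h n + w ∈ classesSupportedOn P.X (Set.range i.base) (2 * n) ∧
      -- (7.3): the embedded deformations of `Z ⊆ P` are unobstructed
      ∀ (A B : Type) [CommRing A] [Algebra ℂ A] [IsArtinianRing A] [IsLocalRing A]
        [CommRing B] [Algebra ℂ B] (f : A →ₐ[ℂ] B), Function.Surjective f →
        IsLocalRing.maximalIdeal A * RingHom.ker f = ⊥ →
        ∀ (ρ : B →ₐ[ℂ] ℂ) ⦃XA XB : Scheme⦄ (gA : XA ⟶ P.X.left) (qA : XA ⟶ Spec (.of A)),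
          IsPullback gA qA P.X.hom (Spec.map (CommRingCat.ofHom (algebraMap ℂ A))) →
          ∀ (iA : XB ⟶ XA) (qB : XB ⟶ Spec (.of B)),
            IsPullback iA qB qA (Spec.map (CommRingCat.ofHom f.toRingHom)) →
            ∀ (j : P.X.left ⟶ XB),
              IsPullback j P.X.hom qB (Spec.map (CommRingCat.ofHom ρ.toRingHom)) →
              j ≫ iA ≫ gA = 𝟙 P.X.left →
              ∀ ⦃ZB : Scheme⦄ (ιB : ZB ⟶ XB), IsClosedImmersion ιB → Flat (ιB ≫ qB) →
                ∀ (jZ : Z ⟶ ZB), IsPullback jZ i ιB j →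
                  ∃ (ZA : Scheme) (ιA : ZA ⟶ XA) (_ : IsClosedImmersion ιA) (_ : Flat (ιA ≫ qA))
                    (iZ : ZB ⟶ ZA), IsPullback iZ ιB ιA iA := by
  obtain ⟨Z, i, q, hi, hreg, hint, hcoh, hsr, hsupp⟩ := hS
  have hX : Motives.IsSmoothProjective (2 * n) P.X := by
    rw [← hP]
    exact Motives.AbelianVariety.isSmoothProjective_holds
  exact ⟨Z, i, q, hi, hreg, hint, hcoh, hsr, hsupp, hBl (2 * n) n hX i hreg hsr⟩

/-- **The hyperbolic-seed form** (the binder shape of №3's `BlochSeedDiscOne = HasHyperbolicBlochSeed 4 1`): granting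
`Bloch1972_hilbertScheme_smoothAt_semiregular`, a hyperbolic Bloch seed in dimension `2n` for `K = ℚ(√-d)`
(`HasHyperbolicBlochSeed n d`: an abelian `2n`-fold `P` with `ψ₀² = -d`, of hyperbolic Weil type, a non-zero rational
Weil class `w` and a Bloch seed for some `q·h_Kⁿ + w`) yields an anchor `P` with `P.dim = 2n` and a Bloch-semiregular
regular immersion `i : Z ↪ P` of codimension `n` whose embedded deformations in `P` are unobstructed (conclusion of
`HasBlochSeedAt.exists_seed_hilbertPointSmooth`, the class clause dropped). PROVED composition; no new fact.
[cite: Bloch1972Semiregularity, Thm. (7.3) and Remark (7.5)] -/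
theorem HasHyperbolicBlochSeed.exists_anchor_seed_hilbertPointSmooth
    (hBl : Bloch1972_hilbertScheme_smoothAt_semiregular) {n d : ℕ} (hS : HasHyperbolicBlochSeed n d) :
    ∃ (P : Motives.AbelianVariety ℂ) (Z : Scheme.{0}) (i : Z ⟶ P.X.left),
      P.dim = 2 * n ∧ IsClosedImmersion i ∧ IsRegularImmersionOfCodim i n ∧ IsBlochSemiregular i (2 * n) n ∧
      ∀ (A B : Type) [CommRing A] [Algebra ℂ A] [IsArtinianRing A] [IsLocalRing A]
        [CommRing B] [Algebra ℂ B] (f : A →ₐ[ℂ] B), Function.Surjective f →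
        IsLocalRing.maximalIdeal A * RingHom.ker f = ⊥ →
        ∀ (ρ : B →ₐ[ℂ] ℂ) ⦃XA XB : Scheme⦄ (gA : XA ⟶ P.X.left) (qA : XA ⟶ Spec (.of A)),
          IsPullback gA qA P.X.hom (Spec.map (CommRingCat.ofHom (algebraMap ℂ A))) →
          ∀ (iA : XB ⟶ XA) (qB : XB ⟶ Spec (.of B)),
            IsPullback iA qB qA (Spec.map (CommRingCat.ofHom f.toRingHom)) →
            ∀ (j : P.X.left ⟶ XB),
              IsPullback j P.X.hom qB (Spec.map (CommRingCat.ofHom ρ.toRingHom)) →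
              j ≫ iA ≫ gA = 𝟙 P.X.left →
              ∀ ⦃ZB : Scheme⦄ (ιB : ZB ⟶ XB), IsClosedImmersion ιB → Flat (ιB ≫ qB) →
                ∀ (jZ : Z ⟶ ZB), IsPullback jZ i ιB j →
                  ∃ (ZA : Scheme) (ιA : ZA ⟶ XA) (_ : IsClosedImmersion ιA) (_ : Flat (ιA ≫ qA))
                    (iZ : ZB ⟶ ZA), IsPullback iZ ιB ιA iA := by
  obtain ⟨P, ψ₀, e, a, w, hP, -, -, -, -, -, -, -, hseed⟩ := hS
  obtain ⟨Z, i, -, hi, hreg, -, -, hsr, -, hlift⟩ := hseed.exists_seed_hilbertPointSmooth hBl hP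
  exact ⟨P, Z, i, hP, hi, hreg, hsr, hlift⟩

end Literature.AlgebraicGeometry.HodgeTheory

end
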